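import Summits.HubbardSuperconductivity.HubbardSuperconductivity.Theorems.NodalWardXYVisonPairCostSymbolDefs

/-!
# Crux `NodalWardXY.VisonPairCost` (stmt-HubbardSuperconductivity-1266), line `Sketch`:
# the stub `stub_symbDerivBounds : SymbDerivBounds` — derivative bounds for the free symbol

Vocabulary: `Theorems/NodalWardXYVisonPairCost{IRDefs,SymbolDefs}.lean` (`symb`, `xiS`, `gapS`,
`symbDen`, `SymbDerivBounds`).  Every entry of `s ↦ symb μ Δ₀ t s k₂ σ σ'` has the form
`f(s) = (1/Q(s)) · N(s)` with the real denominator `Q(s) = symbDen μ Δ₀ t s k₂ = ξ² + Δ̂² + t² > 0`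
(`t > 0`), `ξ(s) = −2cos s − 2cos k₂ − μ`, `Δ̂(s) = 2Δ₀(cos s − cos k₂)`, and a complex numerator
`N ∈ {ξ − it, −Δ̂, −ξ − it}`.  Writing `a = 1 + |Δ₀|`, `r = √Q`:

* `Q' = 4 sin s (ξ − Δ₀Δ̂)`, `Q'' = 4 cos s (ξ − Δ₀Δ̂) + 8(1 + Δ₀²) sin² s`, and `|ξ|, |Δ̂| ≤ r` give
  `|Q'| ≤ 4 a r`, `|Q''| ≤ 8a² + 4 a r`; also `‖N‖ ≤ r`, `‖N'‖, ‖N''‖ ≤ 2a`;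
* `f' = (1/Q)' N + (1/Q) N'`, `f'' = (1/Q)'' N + 2 (1/Q)' N' + (1/Q) N''` with `(1/Q)' = −Q'/Q²`,
  `(1/Q)'' = (2Q'² − Q Q'')/Q³`, whence `‖f'‖ ≤ 6a/Q` and `‖f''‖ ≤ 6a/Q + 56a²/(Q√Q)`; we take
  `C = 64 a²`;
* the swap `k₁ ↔ k₂`: `ξ` and `Q` are symmetric, `Δ̂` is antisymmetric, so the diagonal entries of
  `symb` are symmetric and the off-diagonal ones antisymmetric; the norms of the derivatives agree.

No definition is introduced; Mathlib calculus only.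
-/

noncomputable section

-- tree namespace Summit.HubbardSuperconductivity.HubbardSuperconductivity (D-0017)
set_option linter.dupNamespace false

namespace Summit.HubbardSuperconductivity.HubbardSuperconductivity.Theorems.VisonPairCost

open Summit.HubbardSuperconductivity.HubbardSuperconductivity.Theses.NodalWardXY

/-! ### Generic calculus: two derivatives of `s ↦ (R s : ℂ) * N s` -/

/-- Product rule, applied twice, for a real scalar function times a complex function:
`((R : ℂ) N)' = R' N + R N'` and `((R : ℂ) N)'' = R'' N + 2 R' N' + R N''`. -/
theorem deriv_two_ofReal_mul {R R' R'' : ℝ → ℝ} {N N' N'' : ℝ → ℂ}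
    (hR : ∀ s, HasDerivAt R (R' s) s) (hR' : ∀ s, HasDerivAt R' (R'' s) s)
    (hN : ∀ s, HasDerivAt N (N' s) s) (hN' : ∀ s, HasDerivAt N' (N'' s) s) :
    deriv (fun s => (R s : ℂ) * N s) = (fun s => (R' s : ℂ) * N s + (R s : ℂ) * N' s) ∧
    iteratedDeriv 2 (fun s => (R s : ℂ) * N s) =
      fun s => (R'' s : ℂ) * N s + ((2 * R' s : ℝ) : ℂ) * N' s + (R s : ℂ) * N'' s := by
  have h1 : ∀ s, HasDerivAt (fun s => (R s : ℂ) * N s) ((R' s : ℂ) * N s + (R s : ℂ) * N' s) s :=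
    fun s => ((hR s).ofReal_comp).fun_mul (hN s)
  have hd1 : deriv (fun s => (R s : ℂ) * N s) = fun s => (R' s : ℂ) * N s + (R s : ℂ) * N' s :=
    funext fun s => (h1 s).deriv
  refine ⟨hd1, ?_⟩
  have h2 : ∀ s, HasDerivAt (fun s => (R' s : ℂ) * N s + (R s : ℂ) * N' s)
      ((R'' s : ℂ) * N s + ((2 * R' s : ℝ) : ℂ) * N' s + (R s : ℂ) * N'' s) s := by
    intro s
    have h := (((hR' s).ofReal_comp).fun_mul (hN s)).fun_add (((hR s).ofReal_comp).fun_mul (hN' s))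
    refine h.congr_deriv ?_
    push_cast
    ring
  rw [iteratedDeriv_succ, iteratedDeriv_one, hd1]
  exact funext fun s => (h2 s).deriv

/-! ### The algebra of the bounds -/

/-- The elementary inequalities behind the derivative bounds: with `D = r²`, `|q₁| ≤ 4ar`,
`|q₂| ≤ 8a² + 4ar`, `n₀ ≤ r`, `n₁, n₂ ≤ 2a` one has `|q₁|n₀/D² + n₁/D ≤ 64a²/D` and
`|2q₁² − Dq₂| n₀/D³ + 2|q₁| n₁/D² + n₂/D ≤ 64a² (1/D + 1/(D√D))`. -/
theorem symbDeriv_alg_bound {D a q₁ q₂ n₀ n₁ n₂ : ℝ} (hD : 0 < D) (ha : 1 ≤ a)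
    (hq₁ : |q₁| ≤ 4 * a * Real.sqrt D) (hq₂ : |q₂| ≤ 8 * a ^ 2 + 4 * a * Real.sqrt D)
    (hn₀ : n₀ ≤ Real.sqrt D) (hn₁ : n₁ ≤ 2 * a) (hn₂ : n₂ ≤ 2 * a)
    (h₀ : 0 ≤ n₀) (h₁ : 0 ≤ n₁) :
    |-q₁ / D ^ 2| * n₀ + |D⁻¹| * n₁ ≤ 64 * a ^ 2 / D ∧
    |(2 * q₁ ^ 2 - D * q₂) / D ^ 3| * n₀ + |2 * (-q₁ / D ^ 2)| * n₁ + |D⁻¹| * n₂ ≤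
      64 * a ^ 2 * (1 / D + 1 / (D * Real.sqrt D)) := by
  obtain ⟨r, hr, rfl⟩ : ∃ r : ℝ, 0 < r ∧ D = r ^ 2 :=
    ⟨Real.sqrt D, Real.sqrt_pos.2 hD, (Real.sq_sqrt hD.le).symm⟩
  rw [Real.sqrt_sq hr.le] at hq₁ hq₂ hn₀ ⊢
  have ha0 : 0 ≤ a := le_trans zero_le_one ha
  have hr0 : r ≠ 0 := hr.ne'
  have hr2 : 0 < r ^ 2 := by positivity
  have hq0 : 0 ≤ |q₁| := abs_nonneg _
  have k1 : |q₁| * n₀ ≤ 4 * a * r ^ 2 :=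
    calc |q₁| * n₀ ≤ (4 * a * r) * r := mul_le_mul hq₁ hn₀ h₀ (by positivity)
      _ = 4 * a * r ^ 2 := by ring
  have k2 : q₁ ^ 2 ≤ 16 * a ^ 2 * r ^ 2 :=
    calc q₁ ^ 2 = |q₁| * |q₁| := by rw [← sq, sq_abs]
      _ ≤ (4 * a * r) * (4 * a * r) := mul_le_mul hq₁ hq₁ hq0 (by positivity)
      _ = 16 * a ^ 2 * r ^ 2 := by ring
  have k3 : |2 * q₁ ^ 2 - r ^ 2 * q₂| ≤ 40 * a ^ 2 * r ^ 2 + 4 * a * r ^ 3 :=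
    calc |2 * q₁ ^ 2 - r ^ 2 * q₂| ≤ |2 * q₁ ^ 2| + |r ^ 2 * q₂| := abs_sub _ _
      _ = 2 * q₁ ^ 2 + r ^ 2 * |q₂| := by
          rw [abs_mul, abs_mul, abs_two, abs_of_nonneg (sq_nonneg q₁), abs_of_pos hr2]
      _ ≤ 2 * (16 * a ^ 2 * r ^ 2) + r ^ 2 * (8 * a ^ 2 + 4 * a * r) := by gcongr
      _ = 40 * a ^ 2 * r ^ 2 + 4 * a * r ^ 3 := by ring
  have k4 : |2 * q₁ ^ 2 - r ^ 2 * q₂| * n₀ ≤ 40 * a ^ 2 * r ^ 3 + 4 * a * r ^ 4 :=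
    calc |2 * q₁ ^ 2 - r ^ 2 * q₂| * n₀ ≤ (40 * a ^ 2 * r ^ 2 + 4 * a * r ^ 3) * r :=
          mul_le_mul k3 hn₀ h₀ (by positivity)
      _ = 40 * a ^ 2 * r ^ 3 + 4 * a * r ^ 4 := by ring
  have k5 : |q₁| * n₁ ≤ 8 * a ^ 2 * r :=
    calc |q₁| * n₁ ≤ (4 * a * r) * (2 * a) := mul_le_mul hq₁ hn₁ h₁ (by positivity)
      _ = 8 * a ^ 2 * r := by ring
  constructor
  · calc |-q₁ / (r ^ 2) ^ 2| * n₀ + |(r ^ 2)⁻¹| * n₁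
          = |q₁| * n₀ / r ^ 4 + n₁ / r ^ 2 := by
            simp only [abs_div, abs_neg, abs_inv, abs_pow, abs_of_pos hr]
            ring
      _ ≤ 4 * a * r ^ 2 / r ^ 4 + 2 * a / r ^ 2 := by gcongr
      _ = 6 * a / r ^ 2 := by
            field_simp
            ring
      _ ≤ 64 * a ^ 2 / r ^ 2 := by
            apply div_le_div_of_nonneg_right _ hr2.le
            nlinarith
  · calc |(2 * q₁ ^ 2 - r ^ 2 * q₂) / (r ^ 2) ^ 3| * n₀ + |2 * (-q₁ / (r ^ 2) ^ 2)| * n₁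
            + |(r ^ 2)⁻¹| * n₂
          = |2 * q₁ ^ 2 - r ^ 2 * q₂| * n₀ / r ^ 6 + 2 * (|q₁| * n₁) / r ^ 4 + n₂ / r ^ 2 := by
            simp only [abs_div, abs_mul, abs_neg, abs_inv, abs_pow, abs_two, abs_of_pos hr]
            ring
      _ ≤ (40 * a ^ 2 * r ^ 3 + 4 * a * r ^ 4) / r ^ 6 + 2 * (8 * a ^ 2 * r) / r ^ 4
            + 2 * a / r ^ 2 := by gcongr
      _ = 6 * a / r ^ 2 + 56 * a ^ 2 / r ^ 3 := by
            field_simp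
            ring
      _ ≤ 64 * a ^ 2 / r ^ 2 + 64 * a ^ 2 / r ^ 3 := by
            gcongr ?_ / _ + ?_ / _
            · nlinarith
            · nlinarith
      _ = 64 * a ^ 2 * (1 / r ^ 2 + 1 / (r ^ 2 * r)) := by ring

/-- **One entry** `f = (1/Q)·N` of the symbol: from the derivative data of `Q > 0` and `N` and the
bounds `|Q'| ≤ 4a√Q`, `|Q''| ≤ 8a² + 4a√Q`, `‖N‖ ≤ √Q`, `‖N'‖, ‖N''‖ ≤ 2a` one gets
`‖f'‖ ≤ 64a²/Q` and `‖f''‖ ≤ 64a²(1/Q + 1/(Q√Q))`. -/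
theorem symbEntry_bound {a : ℝ} (ha : 1 ≤ a) {Q Q' Q'' : ℝ → ℝ} {N N' N'' : ℝ → ℂ}
    (hQ : ∀ s, HasDerivAt Q (Q' s) s) (hQ' : ∀ s, HasDerivAt Q' (Q'' s) s) (hpos : ∀ s, 0 < Q s)
    (hN : ∀ s, HasDerivAt N (N' s) s) (hN' : ∀ s, HasDerivAt N' (N'' s) s)
    (bQ' : ∀ s, |Q' s| ≤ 4 * a * Real.sqrt (Q s))
    (bQ'' : ∀ s, |Q'' s| ≤ 8 * a ^ 2 + 4 * a * Real.sqrt (Q s))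
    (bN : ∀ s, ‖N s‖ ≤ Real.sqrt (Q s)) (bN' : ∀ s, ‖N' s‖ ≤ 2 * a) (bN'' : ∀ s, ‖N'' s‖ ≤ 2 * a)
    (s : ℝ) :
    ‖deriv (fun s => ((Q s)⁻¹ : ℝ) * N s) s‖ ≤ 64 * a ^ 2 / Q s ∧
    ‖iteratedDeriv 2 (fun s => ((Q s)⁻¹ : ℝ) * N s) s‖ ≤
      64 * a ^ 2 * (1 / Q s + 1 / (Q s * Real.sqrt (Q s))) := by
  have hR : ∀ s, HasDerivAt (fun s => (Q s)⁻¹) (-Q' s / Q s ^ 2) s :=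
    fun s => (hQ s).fun_inv (hpos s).ne'
  have hR' : ∀ s, HasDerivAt (fun s => -Q' s / Q s ^ 2) ((2 * Q' s ^ 2 - Q s * Q'' s) / Q s ^ 3) s := by
    intro s
    have h := ((hQ' s).fun_neg).fun_div ((hQ s).fun_pow 2) (pow_ne_zero 2 (hpos s).ne')
    refine h.congr_deriv ?_
    have h0 : Q s ≠ 0 := (hpos s).ne'
    field_simp
    norm_num
    ring
  obtain ⟨hd1, hd2⟩ := deriv_two_ofReal_mul hR hR' hN hN'
  obtain ⟨b1, b2⟩ := symbDeriv_alg_bound (hpos s) ha (bQ' s) (bQ'' s) (bN s) (bN' s) (bN'' s)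
    (norm_nonneg _) (norm_nonneg _)
  simp only [hd1, hd2]
  constructor
  · refine le_trans (norm_add_le _ _) ?_
    simpa only [norm_mul, Complex.norm_real, Real.norm_eq_abs] using b1
  · refine le_trans (norm_add₃_le) ?_
    simpa only [norm_mul, Complex.norm_real, Real.norm_eq_abs, abs_mul, abs_two] using b2

/-! ### The concrete denominator `Q = symbDen` -/

section Concrete

variable (μ Δ₀ t k₂ : ℝ)

/-- `∂ₛ ξ(s,k₂) = 2 sin s`. -/
theorem hasDerivAt_xiS_left (s : ℝ) : HasDerivAt (fun s => xiS μ s k₂) (2 * Real.sin s) s := by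
  show HasDerivAt (fun y => -2 * Real.cos y - 2 * Real.cos k₂ - μ) _ s
  have h := (((Real.hasDerivAt_cos s).const_mul (-2)).sub_const (2 * Real.cos k₂)).sub_const μ
  refine h.congr_deriv ?_
  ring

/-- `∂ₛ Δ̂(s,k₂) = −2Δ₀ sin s`. -/
theorem hasDerivAt_gapS_left (s : ℝ) :
    HasDerivAt (fun s => gapS Δ₀ s k₂) (-2 * Δ₀ * Real.sin s) s := by
  show HasDerivAt (fun y => 2 * Δ₀ * (Real.cos y - Real.cos k₂)) _ s
  have h := ((Real.hasDerivAt_cos s).sub_const (Real.cos k₂)).const_mul (2 * Δ₀)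
  refine h.congr_deriv ?_
  ring

/-- `∂ₛ D(s,k₂) = 4 sin s (ξ − Δ₀Δ̂)`. -/
theorem hasDerivAt_symbDen_left (s : ℝ) :
    HasDerivAt (fun s => symbDen μ Δ₀ t s k₂)
      (4 * Real.sin s * (xiS μ s k₂ - Δ₀ * gapS Δ₀ s k₂)) s := by
  show HasDerivAt (fun y => xiS μ y k₂ ^ 2 + gapS Δ₀ y k₂ ^ 2 + t ^ 2) _ s
  have h := (((hasDerivAt_xiS_left μ k₂ s).fun_pow 2).fun_add
    ((hasDerivAt_gapS_left Δ₀ k₂ s).fun_pow 2)).add_const (t ^ 2)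
  refine h.congr_deriv ?_
  norm_num
  ring

/-- `∂ₛ² D(s,k₂) = 4 cos s (ξ − Δ₀Δ̂) + 8(1 + Δ₀²) sin² s`. -/
theorem hasDerivAt_symbDen_deriv_left (s : ℝ) :
    HasDerivAt (fun s => 4 * Real.sin s * (xiS μ s k₂ - Δ₀ * gapS Δ₀ s k₂))
      (4 * Real.cos s * (xiS μ s k₂ - Δ₀ * gapS Δ₀ s k₂) + 8 * (1 + Δ₀ ^ 2) * Real.sin s ^ 2) s := by
  have h := ((Real.hasDerivAt_sin s).const_mul 4).fun_mul
    ((hasDerivAt_xiS_left μ k₂ s).fun_sub ((hasDerivAt_gapS_left Δ₀ k₂ s).const_mul Δ₀))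
  refine h.congr_deriv ?_
  ring

/-- `|ξ| ≤ √D`. -/
theorem abs_xiS_le_sqrt (k₁ : ℝ) : |xiS μ k₁ k₂| ≤ Real.sqrt (symbDen μ Δ₀ t k₁ k₂) :=
  Real.abs_le_sqrt (by unfold symbDen; nlinarith [sq_nonneg (gapS Δ₀ k₁ k₂), sq_nonneg t])

/-- `|Δ̂| ≤ √D`. -/
theorem abs_gapS_le_sqrt (k₁ : ℝ) : |gapS Δ₀ k₁ k₂| ≤ Real.sqrt (symbDen μ Δ₀ t k₁ k₂) :=
  Real.abs_le_sqrt (by unfold symbDen; nlinarith [sq_nonneg (xiS μ k₁ k₂), sq_nonneg t])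

/-- `|4c(ξ − Δ₀Δ̂)| ≤ 4(1 + |Δ₀|)√D` for `|c| ≤ 1` (used with `c = sin s`: `|D'| ≤ 4(1 + |Δ₀|)√D`,
and with `c = cos s` in `D''`). -/
theorem abs_four_mul_xiS_sub_le {c : ℝ} (hc : |c| ≤ 1) (k₁ : ℝ) :
    |4 * c * (xiS μ k₁ k₂ - Δ₀ * gapS Δ₀ k₁ k₂)| ≤
      4 * (1 + |Δ₀|) * Real.sqrt (symbDen μ Δ₀ t k₁ k₂) := by
  have h1 := abs_xiS_le_sqrt μ Δ₀ t k₂ k₁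
  have h2 := abs_gapS_le_sqrt μ Δ₀ t k₂ k₁
  have h3 : |xiS μ k₁ k₂ - Δ₀ * gapS Δ₀ k₁ k₂| ≤ (1 + |Δ₀|) * Real.sqrt (symbDen μ Δ₀ t k₁ k₂) :=
    calc _ ≤ |xiS μ k₁ k₂| + |Δ₀ * gapS Δ₀ k₁ k₂| := abs_sub _ _
      _ ≤ Real.sqrt (symbDen μ Δ₀ t k₁ k₂) + |Δ₀| * Real.sqrt (symbDen μ Δ₀ t k₁ k₂) := by
          rw [abs_mul]; gcongr
      _ = (1 + |Δ₀|) * Real.sqrt (symbDen μ Δ₀ t k₁ k₂) := by ring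
  rw [abs_mul, abs_mul, abs_of_pos (by norm_num : (0 : ℝ) < 4)]
  calc 4 * |c| * |xiS μ k₁ k₂ - Δ₀ * gapS Δ₀ k₁ k₂|
        ≤ 4 * 1 * ((1 + |Δ₀|) * Real.sqrt (symbDen μ Δ₀ t k₁ k₂)) := by gcongr
    _ = 4 * (1 + |Δ₀|) * Real.sqrt (symbDen μ Δ₀ t k₁ k₂) := by ring

/-- `|D''| ≤ 8(1 + |Δ₀|)² + 4(1 + |Δ₀|)√D`. -/
theorem abs_symbDen_deriv2_le (s : ℝ) :
    |4 * Real.cos s * (xiS μ s k₂ - Δ₀ * gapS Δ₀ s k₂) + 8 * (1 + Δ₀ ^ 2) * Real.sin s ^ 2| ≤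
      8 * (1 + |Δ₀|) ^ 2 + 4 * (1 + |Δ₀|) * Real.sqrt (symbDen μ Δ₀ t s k₂) := by
  have hA := abs_four_mul_xiS_sub_le μ Δ₀ t k₂ (Real.abs_cos_le_one s) s
  have hB : |8 * (1 + Δ₀ ^ 2) * Real.sin s ^ 2| ≤ 8 * (1 + |Δ₀|) ^ 2 := by
    rw [abs_of_nonneg (by positivity)]
    have hΔ : Δ₀ ^ 2 ≤ (1 + |Δ₀|) ^ 2 - 1 := by rw [← sq_abs Δ₀]; nlinarith [abs_nonneg Δ₀]
    nlinarith [sq_nonneg (Real.sin s), sq_nonneg Δ₀, Real.sin_sq_le_one s]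
  exact (abs_add_le _ _).trans (by linarith)

variable {t}

/-- **Entry bound with the concrete denominator**: for a numerator `N` with `‖N‖ ≤ √D`,
`‖N'‖, ‖N''‖ ≤ 2(1 + |Δ₀|)`, the entry `s ↦ (D(s,k₂))⁻¹ N(s)` satisfies the two derivative bounds
with `C = 64(1 + |Δ₀|)²`. -/
theorem symbEntry_bound_den (ht : 0 < t) {N N' N'' : ℝ → ℂ}
    (hN : ∀ s, HasDerivAt N (N' s) s) (hN' : ∀ s, HasDerivAt N' (N'' s) s)
    (bN : ∀ s, ‖N s‖ ≤ Real.sqrt (symbDen μ Δ₀ t s k₂))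
    (bN' : ∀ s, ‖N' s‖ ≤ 2 * (1 + |Δ₀|)) (bN'' : ∀ s, ‖N'' s‖ ≤ 2 * (1 + |Δ₀|)) (k₁ : ℝ) :
    ‖deriv (fun s => ((symbDen μ Δ₀ t s k₂)⁻¹ : ℝ) * N s) k₁‖ ≤
        64 * (1 + |Δ₀|) ^ 2 / symbDen μ Δ₀ t k₁ k₂ ∧
    ‖iteratedDeriv 2 (fun s => ((symbDen μ Δ₀ t s k₂)⁻¹ : ℝ) * N s) k₁‖ ≤
      64 * (1 + |Δ₀|) ^ 2 * (1 / symbDen μ Δ₀ t k₁ k₂ +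
        1 / (symbDen μ Δ₀ t k₁ k₂ * Real.sqrt (symbDen μ Δ₀ t k₁ k₂))) := by
  have ha : (1 : ℝ) ≤ 1 + |Δ₀| := le_add_of_nonneg_right (abs_nonneg _)
  exact symbEntry_bound ha (Q := fun s => symbDen μ Δ₀ t s k₂)
    (hasDerivAt_symbDen_left μ Δ₀ t k₂) (hasDerivAt_symbDen_deriv_left μ Δ₀ k₂)
    (fun s => by unfold symbDen; positivity) hN hN'
    (fun s => abs_four_mul_xiS_sub_le μ Δ₀ t k₂ (Real.abs_sin_le_one s) s)
    (abs_symbDen_deriv2_le μ Δ₀ t k₂) bN bN' bN'' k₁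

end Concrete

/-! ### The three numerators -/

section Numerators

variable (μ Δ₀ : ℝ) {t : ℝ} (k₂ : ℝ)

/-- The `(0,0)` entry `(ξ − it)/D`: derivative bounds. -/
theorem symbEntry00_bound (ht : 0 < t) (k₁ : ℝ) :
    ‖deriv (fun s => ((symbDen μ Δ₀ t s k₂)⁻¹ : ℝ) * ((xiS μ s k₂ : ℂ) - (t : ℂ) * Complex.I)) k₁‖ ≤
        64 * (1 + |Δ₀|) ^ 2 / symbDen μ Δ₀ t k₁ k₂ ∧
    ‖iteratedDeriv 2 (fun s => ((symbDen μ Δ₀ t s k₂)⁻¹ : ℝ) *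
        ((xiS μ s k₂ : ℂ) - (t : ℂ) * Complex.I)) k₁‖ ≤
      64 * (1 + |Δ₀|) ^ 2 * (1 / symbDen μ Δ₀ t k₁ k₂ +
        1 / (symbDen μ Δ₀ t k₁ k₂ * Real.sqrt (symbDen μ Δ₀ t k₁ k₂))) := by
  refine symbEntry_bound_den μ Δ₀ k₂ ht (N' := fun s => ((2 * Real.sin s : ℝ) : ℂ))
    (N'' := fun s => ((2 * Real.cos s : ℝ) : ℂ))
    (fun s => ((hasDerivAt_xiS_left μ k₂ s).ofReal_comp).sub_const ((t : ℂ) * Complex.I))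
    (fun s => ((Real.hasDerivAt_sin s).const_mul 2).ofReal_comp) ?_ ?_ ?_ k₁
  · intro s
    have e : (xiS μ s k₂ : ℂ) - (t : ℂ) * Complex.I = (xiS μ s k₂ : ℂ) + ((-t : ℝ) : ℂ) * Complex.I := by
      push_cast; ring
    rw [e, Complex.norm_add_mul_I]
    exact Real.sqrt_le_sqrt (by rw [neg_sq]; unfold symbDen; nlinarith [sq_nonneg (gapS Δ₀ s k₂)])
  · intro s
    rw [Complex.norm_real, Real.norm_eq_abs, abs_mul, abs_two]
    nlinarith [Real.abs_sin_le_one s, abs_nonneg Δ₀]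
  · intro s
    rw [Complex.norm_real, Real.norm_eq_abs, abs_mul, abs_two]
    nlinarith [Real.abs_cos_le_one s, abs_nonneg Δ₀]

/-- The `(1,1)` entry `(−ξ − it)/D`: derivative bounds. -/
theorem symbEntry11_bound (ht : 0 < t) (k₁ : ℝ) :
    ‖deriv (fun s => ((symbDen μ Δ₀ t s k₂)⁻¹ : ℝ) * (-(xiS μ s k₂ : ℂ) - (t : ℂ) * Complex.I)) k₁‖ ≤
        64 * (1 + |Δ₀|) ^ 2 / symbDen μ Δ₀ t k₁ k₂ ∧
    ‖iteratedDeriv 2 (fun s => ((symbDen μ Δ₀ t s k₂)⁻¹ : ℝ) *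
        (-(xiS μ s k₂ : ℂ) - (t : ℂ) * Complex.I)) k₁‖ ≤
      64 * (1 + |Δ₀|) ^ 2 * (1 / symbDen μ Δ₀ t k₁ k₂ +
        1 / (symbDen μ Δ₀ t k₁ k₂ * Real.sqrt (symbDen μ Δ₀ t k₁ k₂))) := by
  refine symbEntry_bound_den μ Δ₀ k₂ ht (N' := fun s => -((2 * Real.sin s : ℝ) : ℂ))
    (N'' := fun s => -((2 * Real.cos s : ℝ) : ℂ))
    (fun s => ((hasDerivAt_xiS_left μ k₂ s).ofReal_comp).fun_neg.sub_const ((t : ℂ) * Complex.I))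
    (fun s => ((Real.hasDerivAt_sin s).const_mul 2).ofReal_comp.fun_neg) ?_ ?_ ?_ k₁
  · intro s
    have e : -(xiS μ s k₂ : ℂ) - (t : ℂ) * Complex.I =
        ((-xiS μ s k₂ : ℝ) : ℂ) + ((-t : ℝ) : ℂ) * Complex.I := by
      push_cast; ring
    rw [e, Complex.norm_add_mul_I]
    exact Real.sqrt_le_sqrt (by rw [neg_sq, neg_sq]; unfold symbDen; nlinarith [sq_nonneg (gapS Δ₀ s k₂)])
  · intro s
    rw [norm_neg, Complex.norm_real, Real.norm_eq_abs, abs_mul, abs_two]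
    nlinarith [Real.abs_sin_le_one s, abs_nonneg Δ₀]
  · intro s
    rw [norm_neg, Complex.norm_real, Real.norm_eq_abs, abs_mul, abs_two]
    nlinarith [Real.abs_cos_le_one s, abs_nonneg Δ₀]

/-- The off-diagonal entry `−Δ̂/D`: derivative bounds. -/
theorem symbEntry01_bound (ht : 0 < t) (k₁ : ℝ) :
    ‖deriv (fun s => ((symbDen μ Δ₀ t s k₂)⁻¹ : ℝ) * (-(gapS Δ₀ s k₂) : ℂ)) k₁‖ ≤
        64 * (1 + |Δ₀|) ^ 2 / symbDen μ Δ₀ t k₁ k₂ ∧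
    ‖iteratedDeriv 2 (fun s => ((symbDen μ Δ₀ t s k₂)⁻¹ : ℝ) * (-(gapS Δ₀ s k₂) : ℂ)) k₁‖ ≤
      64 * (1 + |Δ₀|) ^ 2 * (1 / symbDen μ Δ₀ t k₁ k₂ +
        1 / (symbDen μ Δ₀ t k₁ k₂ * Real.sqrt (symbDen μ Δ₀ t k₁ k₂))) := by
  refine symbEntry_bound_den μ Δ₀ k₂ ht (N' := fun s => -((-2 * Δ₀ * Real.sin s : ℝ) : ℂ))
    (N'' := fun s => -((-2 * Δ₀ * Real.cos s : ℝ) : ℂ))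
    (fun s => ((hasDerivAt_gapS_left Δ₀ k₂ s).ofReal_comp).fun_neg)
    (fun s => ((Real.hasDerivAt_sin s).const_mul (-2 * Δ₀)).ofReal_comp.fun_neg) ?_ ?_ ?_ k₁
  · intro s
    rw [norm_neg, Complex.norm_real, Real.norm_eq_abs]
    exact abs_gapS_le_sqrt μ Δ₀ t k₂ s
  · intro s
    rw [norm_neg, Complex.norm_real, Real.norm_eq_abs, abs_mul, abs_mul, abs_neg, abs_two]
    nlinarith [Real.abs_sin_le_one s, abs_nonneg Δ₀, abs_nonneg (Real.sin s)]
  · intro s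
    rw [norm_neg, Complex.norm_real, Real.norm_eq_abs, abs_mul, abs_mul, abs_neg, abs_two]
    nlinarith [Real.abs_cos_le_one s, abs_nonneg Δ₀, abs_nonneg (Real.cos s)]

end Numerators

/-! ### The bounds for every entry, and the swap symmetry -/

/-- Both derivative bounds for every entry of `s ↦ symb μ Δ₀ t s k₂ σ σ'`, `C = 64(1 + |Δ₀|)²`. -/
theorem symb_deriv_bounds (μ Δ₀ : ℝ) {t : ℝ} (ht : 0 < t) (k₁ k₂ : ℝ) (σ σ' : Fin 2) :
    ‖deriv (fun s => symb μ Δ₀ t s k₂ σ σ') k₁‖ ≤ 64 * (1 + |Δ₀|) ^ 2 / symbDen μ Δ₀ t k₁ k₂ ∧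
    ‖iteratedDeriv 2 (fun s => symb μ Δ₀ t s k₂ σ σ') k₁‖ ≤
      64 * (1 + |Δ₀|) ^ 2 * (1 / symbDen μ Δ₀ t k₁ k₂ +
        1 / (symbDen μ Δ₀ t k₁ k₂ * Real.sqrt (symbDen μ Δ₀ t k₁ k₂))) := by
  by_cases h0 : σ = 0 <;> by_cases h1 : σ' = 0 <;> simp only [symb, h0, h1, if_true, if_false]
  · exact symbEntry00_bound μ Δ₀ k₂ ht k₁
  · exact symbEntry01_bound μ Δ₀ k₂ ht k₁
  · exact symbEntry01_bound μ Δ₀ k₂ ht k₁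
  · exact symbEntry11_bound μ Δ₀ k₂ ht k₁

/-- Swap symmetry of the entries: `symb(a,b)_{σσ'} = symb(b,a)_{σσ'}` on the diagonal and
`= −symb(b,a)_{σσ'}` off the diagonal (`ξ`, `D` symmetric, `Δ̂` antisymmetric). -/
theorem symb_swap (μ Δ₀ t a b : ℝ) (σ σ' : Fin 2) :
    symb μ Δ₀ t b a σ σ' = (if σ = σ' then symb μ Δ₀ t a b σ σ' else -symb μ Δ₀ t a b σ σ') := by
  have hξ : xiS μ b a = xiS μ a b := by unfold xiS; ring
  have hΔ : gapS Δ₀ b a = -gapS Δ₀ a b := by unfold gapS; ring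
  unfold symb
  rw [hξ, hΔ, neg_sq]
  fin_cases σ <;> fin_cases σ' <;> simp

/-! ### The registered stub -/

/-- **(S-1) Derivative bounds for the free symbol** (registered stub of line `Sketch`): with
`C = 64(1 + |Δ₀|)²`, for `t > 0`, `‖∂ₛ symb(s,k₂)‖ ≤ C/D(s,k₂)`,
`‖∂ₛ² symb(s,k₂)‖ ≤ C(1/D + 1/(D√D))`, and the norms of the derivatives in the second momentum agree
with those in the first (swap symmetry). -/
theorem stub_symbDerivBounds : SymbDerivBounds := by
  intro μ Δ₀
  refine ⟨64 * (1 + |Δ₀|) ^ 2, by positivity, ?_⟩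
  intro t ht k₁ k₂ σ σ'
  obtain ⟨b1, b2⟩ := symb_deriv_bounds μ Δ₀ ht k₁ k₂ σ σ'
  have hsw : (fun s => symb μ Δ₀ t k₂ s σ σ') =
      fun s => (if σ = σ' then symb μ Δ₀ t s k₂ σ σ' else -symb μ Δ₀ t s k₂ σ σ') :=
    funext fun s => symb_swap μ Δ₀ t s k₂ σ σ'
  refine ⟨b1, b2, ?_, ?_⟩
  · rw [hsw]
    by_cases h : σ = σ'
    · simp only [h, if_true]
    · simp only [h, if_false, deriv.fun_neg', norm_neg]
  · rw [hsw]
    by_cases h : σ = σ'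
    · simp only [h, if_true]
    · simp only [h, if_false, iteratedDeriv_fun_neg, norm_neg]

end Summit.HubbardSuperconductivity.HubbardSuperconductivity.Theorems.VisonPairCost

end
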